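import Summits.QuantumFields.YangMills.Theorems.UnitScaleTiltProp7N32SymLevelSums
import HarnessLib

/-!
# Route `UnitScaleTilt`, crux K1 «MinimiserStabilityRegPr» (stmt-QuantumFields-19200), route-R (β) R0 REM2ˢ, row «(n3)₂-sym» = H2-1ˢ, file N6c-R —
# THE REAL BOOKKEEPING OF THE «(n3)₂-sym» KNIT (pure real arithmetic; every letter a real variable)

Cell `ym3-torus` (D-0037: YM₃ on T³ is rung R3 — not d = 4, not a mass gap, not Clay), width seat `ym3-torus-px21` (gen 7), pen of the «(n3)₂-sym» supplier.
THEOREMS ONLY; `--supports stmt-QuantumFields-19200 --as helper`, count-neutral; nothing here claims the row, (β), the stub or the crux.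
§1 (R6)(R7) two single level sums after ✓N5 `Prop7N32SymLevelSums`; §2 ★`real_assembly`: ✓N6b's right-hand side in short letters `≤ A·(Lᵏ)⁻¹ + B·Lᵏ` under the displayed
rows ((n3) masses, N6d deviations, N4∕S localised level-0 masses, `E ≤ 3∕2`, `E′ ≤ 9∕4`); §3 four scalar shapes of the member discharge.  (The currency exchange and
the absolute constants of `hN2s` are in the sibling file `…N32SymExchangeReals`.)
References: T. Bałaban, CMP 98 (1985) 17–51 [Balaban1985Averaging] ((97)–(100) p.32, Prop. 3 (122)–(126) p.36); CMP 102 (1985) 277–309 [Balaban1985Variational]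
((15) p.280, (19)–(20) p.281, (47)–(48) pp.285–286).
-/

set_option autoImplicit false

noncomputable section

open scoped BigOperators

namespace Summit.QuantumFields.YangMills.Theorems.Prop7N32SymLevelRowReals

open Finset
open Summit.QuantumFields.YangMills.Theorems.Prop7N32SymLevelSums (sum_pow_le row_R1 row_R2 row_R3 row_R5a row_R5b)

section Real

variable {L ρ₁ ρ₂ : ℝ}


/-- `l ≤ Lˡ` for `2 ≤ L` (real form of `n < 2ⁿ`). [folklore] -/
theorem nat_cast_le_pow (hL : 2 ≤ L) : ∀ l : ℕ, (l : ℝ) ≤ L ^ l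
  | 0 => by norm_num
  | l + 1 => by
      have ih := nat_cast_le_pow hL l
      have hL0 : (0 : ℝ) ≤ L := by linarith
      have h1 : (1 : ℝ) ≤ L ^ l := one_le_pow₀ (by linarith)
      have hLl : 0 ≤ L ^ l := pow_nonneg hL0 l
      push_cast
      calc (l : ℝ) + 1 ≤ L ^ l + L ^ l := add_le_add ih h1
        _ ≤ L ^ l * L := by nlinarith
        _ = L ^ (l + 1) := (pow_succ L l).symm

/-- ★ (R6) `Σ_{j<l} ρ₁ʲ·(L^{j+2}∕Lˡ)³ ≤ L⁶∕(L−1)·(Lˡ)⁻¹` for `2 ≤ L`, `0 ≤ ρ₁ ≤ (L²)⁻¹`. [cite: Balaban1985Averaging, (97)-(100) p.32] -/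
theorem row_R6 (hL : 2 ≤ L) (hρ₁0 : 0 ≤ ρ₁) (hρ₁ : ρ₁ ≤ (L ^ 2)⁻¹) (l : ℕ) :
    ∑ j ∈ range l, ρ₁ ^ j * (L ^ (j + 2) / L ^ l) ^ 3 ≤ L ^ 6 / (L - 1) * (L ^ l)⁻¹ := by
  have hL0 : 0 < L := by linarith
  have hL1 : 1 < L := by linarith
  have hLm1 : 0 < L - 1 := by linarith
  have hLl : 0 < L ^ l := by positivity
  have key : ∀ j ∈ range l, ρ₁ ^ j * (L ^ (j + 2) / L ^ l) ^ 3 ≤ L ^ 6 * ((L ^ l) ^ 3)⁻¹ * L ^ j := by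
    intro j _
    have h1 : ρ₁ ^ j ≤ ((L ^ 2)⁻¹) ^ j := pow_le_pow_left₀ hρ₁0 hρ₁ j
    have h2 : ((L ^ 2)⁻¹) ^ j * (L ^ (j + 2) / L ^ l) ^ 3 = L ^ 6 * ((L ^ l) ^ 3)⁻¹ * L ^ j := by
      have hL2j : (L ^ 2) ^ j ≠ 0 := by positivity
      rw [inv_pow, div_pow]
      field_simp
      ring
    calc ρ₁ ^ j * (L ^ (j + 2) / L ^ l) ^ 3 ≤ ((L ^ 2)⁻¹) ^ j * (L ^ (j + 2) / L ^ l) ^ 3 :=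
          mul_le_mul_of_nonneg_right h1 (by positivity)
      _ = _ := h2
  have hinv1 : (L ^ l)⁻¹ ≤ 1 := inv_le_one_of_one_le₀ (one_le_pow₀ hL1.le)
  calc ∑ j ∈ range l, ρ₁ ^ j * (L ^ (j + 2) / L ^ l) ^ 3 ≤ ∑ j ∈ range l, L ^ 6 * ((L ^ l) ^ 3)⁻¹ * L ^ j := sum_le_sum key
    _ = L ^ 6 * ((L ^ l) ^ 3)⁻¹ * ∑ j ∈ range l, L ^ j := by rw [Finset.mul_sum]
    _ ≤ L ^ 6 * ((L ^ l) ^ 3)⁻¹ * (L ^ l / (L - 1)) := mul_le_mul_of_nonneg_left (sum_pow_le hL1 l) (by positivity)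
    _ = L ^ 6 / (L - 1) * (L ^ l)⁻¹ * (L ^ l)⁻¹ := by
        field_simp
    _ ≤ L ^ 6 / (L - 1) * (L ^ l)⁻¹ * 1 := mul_le_mul_of_nonneg_left hinv1 (by positivity)
    _ = L ^ 6 / (L - 1) * (L ^ l)⁻¹ := mul_one _

/-- ★ (R7) `Σ_{j<l} ρ₁ʲ·L^{2(j+1)} ≤ L²·Lˡ` for `2 ≤ L`, `0 ≤ ρ₁ ≤ (L²)⁻¹` (termwise `≤ L²`, `l ≤ Lˡ`). [cite: Balaban1985Averaging, (97)-(100) p.32] -/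
theorem row_R7 (hL : 2 ≤ L) (hρ₁0 : 0 ≤ ρ₁) (hρ₁ : ρ₁ ≤ (L ^ 2)⁻¹) (l : ℕ) :
    ∑ j ∈ range l, ρ₁ ^ j * L ^ (2 * (j + 1)) ≤ L ^ 2 * L ^ l := by
  have hL0 : 0 < L := by linarith
  have key : ∀ j ∈ range l, ρ₁ ^ j * L ^ (2 * (j + 1)) ≤ L ^ 2 := by
    intro j _
    have h1 : ρ₁ ^ j ≤ ((L ^ 2)⁻¹) ^ j := pow_le_pow_left₀ hρ₁0 hρ₁ j
    have h2 : ((L ^ 2)⁻¹) ^ j * L ^ (2 * (j + 1)) = L ^ 2 := by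
      have hL2j : (L ^ 2) ^ j ≠ 0 := by positivity
      rw [inv_pow]
      field_simp
      ring
    calc ρ₁ ^ j * L ^ (2 * (j + 1)) ≤ ((L ^ 2)⁻¹) ^ j * L ^ (2 * (j + 1)) := mul_le_mul_of_nonneg_right h1 (by positivity)
      _ = L ^ 2 := h2
  calc ∑ j ∈ range l, ρ₁ ^ j * L ^ (2 * (j + 1)) ≤ ∑ j ∈ range l, L ^ 2 := sum_le_sum key
    _ = l * L ^ 2 := by rw [Finset.sum_const, Finset.card_range, nsmul_eq_mul]
    _ ≤ L ^ l * L ^ 2 := mul_le_mul_of_nonneg_right (nat_cast_le_pow hL l) (by positivity)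
    _ = L ^ 2 * L ^ l := mul_comm _ _

/-! ## §2 ★ The pure-real assembly -/

/-- ★ **THE REAL BOOKKEEPING OF THE LEVEL ROW**: ✓N6b's right-hand side in short letters is `≤ A·(Lᵏ)⁻¹ + B·Lᵏ` under the displayed rows `mass_i ≤ AM(Lⁱ)⁻¹ + BM·Lⁱ`,
`dev_i ≤ BD·Lⁱ`, `loc•_j ≤ 2(L^{j+2}∕Lᵏ)³M• + c_G·L^{2(j+1)}·GAP•`, `E ≤ 3∕2`, `0 ≤ E′ ≤ 9∕4`, by ✓N5 (R1)(R2)(R3)(R5a)(R5b) and (R6)(R7). [cite: Balaban1985Averaging, Prop. 3 (122)-(126) p.36] -/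
theorem real_assembly {cE Cd CL td cG D0 AM BM BD M₀' GAP₀ M₁ GAP₁ : ℝ} (k : ℕ)
    (hL : 2 ≤ L) (hρ₁0 : 0 ≤ ρ₁) (hρ₁ : ρ₁ ≤ (L ^ 2)⁻¹) (hρ₂0 : 0 ≤ ρ₂) (hρ₂ : ρ₂ ≤ L⁻¹)
    (hcE : 0 ≤ cE) (hCd : 0 ≤ Cd) (hCL : 0 ≤ CL) (htd : 0 ≤ td) (hcG : 0 ≤ cG) (hD0 : 0 ≤ D0)
    (hAM : 0 ≤ AM) (hBM : 0 ≤ BM) (hBD : 0 ≤ BD) (hM₀' : 0 ≤ M₀') (hGAP₀ : 0 ≤ GAP₀) (hM₁ : 0 ≤ M₁) (hGAP₁ : 0 ≤ GAP₁)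
    (E E' mass dev loc0 loc1 : ℕ → ℝ)
    (hE : ∀ j ≤ k, E j ≤ 3 / 2) (hE'0 : ∀ i, 0 ≤ E' i) (hE' : ∀ i < k, E' i ≤ 9 / 4)
    (hmass0 : ∀ i, 0 ≤ mass i) (hdev0 : ∀ i, 0 ≤ dev i) (hloc00 : ∀ j, 0 ≤ loc0 j) (hloc10 : ∀ j, 0 ≤ loc1 j)
    (hM : ∀ i < k, mass i ≤ AM * (L ^ i)⁻¹ + BM * L ^ i) (hDev : ∀ i < k, dev i ≤ BD * L ^ i)
    (hLoc0 : ∀ j < k, loc0 j ≤ 2 * (L ^ (j + 2) / L ^ k) ^ 3 * M₀' + cG * L ^ (2 * (j + 1)) * GAP₀)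
    (hLoc1 : ∀ j < k, loc1 j ≤ 2 * (L ^ (j + 2) / L ^ k) ^ 3 * M₁ + cG * L ^ (2 * (j + 1)) * GAP₁) :
    E k * (ρ₁ ^ k * D0 + ∑ i ∈ range k, ρ₁ ^ (k - 1 - i) * (cE * mass i))
        + Cd * ∑ j ∈ range k, CL * (E j * (ρ₁ ^ j * loc1 j
            + ∑ i ∈ range j, ρ₁ ^ (j - 1 - i) * (cE * (2 * (ρ₂ ^ i * E' i * loc0 j) + 2 * (td * dev i)))))
      ≤ (3 / 2 * D0 + 3 / 2 * (cE * AM) * ((L - 1)⁻¹ * L ^ 2) + Cd * (CL * (3 / 2)) * (2 * M₁ * (L ^ 6 / (L - 1)))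
            + Cd * (CL * (3 / 2)) * (cE * (9 / 2) * (2 * M₀') * (L ^ 8 / ((L ^ 2 - 1) * (L - 1))))) * (L ^ k)⁻¹
        + (3 / 2 * (cE * BM) * (1 - L⁻¹ ^ 3)⁻¹ + Cd * (CL * (3 / 2)) * (cG * GAP₁ * L ^ 2)
            + Cd * (CL * (3 / 2)) * (cE * (9 / 2) * (cG * GAP₀) * (L ^ 4 * ((L - 1) ^ 2)⁻¹))
            + Cd * (CL * (3 / 2)) * (cE * (2 * td) * BD * ((1 - L⁻¹ ^ 3)⁻¹ * (L - 1)⁻¹))) * L ^ k := by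
  have hL0 : 0 < L := by linarith
  have hL1 : 1 < L := by linarith
  have hLm1 : 0 < L - 1 := by linarith
  have hL21 : 0 < L ^ 2 - 1 := by nlinarith
  have hLk1 : 1 ≤ L ^ k := one_le_pow₀ hL1.le
  have hLk0 : 0 < L ^ k := by positivity
  have hgeom : 0 < 1 - L⁻¹ ^ 3 := by
    have : L⁻¹ ^ 3 < 1 := pow_lt_one₀ (by positivity) (inv_lt_one_of_one_lt₀ hL1) (by norm_num)
    linarith
  -- (T1) the level-0 second-order mass
  have hT1 : E k * (ρ₁ ^ k * D0) ≤ 3 / 2 * D0 * (L ^ k)⁻¹ := by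
    have h1 : ρ₁ ^ k ≤ (L ^ k)⁻¹ := by
      calc ρ₁ ^ k ≤ ((L ^ 2)⁻¹) ^ k := pow_le_pow_left₀ hρ₁0 hρ₁ k
        _ = (L ^ k)⁻¹ * (L ^ k)⁻¹ := by rw [inv_pow, ← pow_mul, mul_comm 2 k, pow_mul, sq, mul_inv]
        _ ≤ (L ^ k)⁻¹ * 1 := mul_le_mul_of_nonneg_left (inv_le_one_of_one_le₀ hLk1) (by positivity)
        _ = (L ^ k)⁻¹ := mul_one _
    calc E k * (ρ₁ ^ k * D0) ≤ 3 / 2 * ((L ^ k)⁻¹ * D0) :=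
          mul_le_mul (hE k le_rfl) (mul_le_mul_of_nonneg_right h1 hD0) (by positivity) (by norm_num)
      _ = 3 / 2 * D0 * (L ^ k)⁻¹ := by ring
  -- (T2) the global first-order masses through the mass channel (R5a)(R5b)
  have hT2 : E k * ∑ i ∈ range k, ρ₁ ^ (k - 1 - i) * (cE * mass i)
      ≤ 3 / 2 * (cE * AM) * ((L - 1)⁻¹ * L ^ 2) * (L ^ k)⁻¹ + 3 / 2 * (cE * BM) * (1 - L⁻¹ ^ 3)⁻¹ * L ^ k := by
    have hsum : ∑ i ∈ range k, ρ₁ ^ (k - 1 - i) * (cE * mass i)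
        ≤ cE * AM * ∑ i ∈ range k, ρ₁ ^ (k - 1 - i) * (L ^ i)⁻¹ + cE * BM * ∑ i ∈ range k, ρ₁ ^ (k - 1 - i) * L ^ i := by
      rw [Finset.mul_sum, Finset.mul_sum, ← Finset.sum_add_distrib]
      refine Finset.sum_le_sum fun i hi => ?_
      have hik := Finset.mem_range.mp hi
      have h := mul_le_mul_of_nonneg_left (hM i hik) (show 0 ≤ ρ₁ ^ (k - 1 - i) * cE by positivity)
      calc ρ₁ ^ (k - 1 - i) * (cE * mass i) = ρ₁ ^ (k - 1 - i) * cE * mass i := by ring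
        _ ≤ ρ₁ ^ (k - 1 - i) * cE * (AM * (L ^ i)⁻¹ + BM * L ^ i) := h
        _ = cE * AM * (ρ₁ ^ (k - 1 - i) * (L ^ i)⁻¹) + cE * BM * (ρ₁ ^ (k - 1 - i) * L ^ i) := by ring
    have h5a := row_R5a hL1 hρ₁0 hρ₁ k
    have h5b' : ∑ i ∈ range k, ρ₁ ^ (k - 1 - i) * L ^ i ≤ (1 - L⁻¹ ^ 3)⁻¹ * L ^ k :=
      (row_R5b hL1 hρ₁0 hρ₁ k).trans (mul_le_mul_of_nonneg_left (pow_le_pow_right₀ hL1.le (Nat.sub_le k 1)) (inv_pos.mpr hgeom).le)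
    have hS0 : 0 ≤ ∑ i ∈ range k, ρ₁ ^ (k - 1 - i) * (cE * mass i) := Finset.sum_nonneg fun i _ => by
      have := hmass0 i; positivity
    calc E k * ∑ i ∈ range k, ρ₁ ^ (k - 1 - i) * (cE * mass i) ≤ 3 / 2 * ∑ i ∈ range k, ρ₁ ^ (k - 1 - i) * (cE * mass i) :=
          mul_le_mul_of_nonneg_right (hE k le_rfl) hS0
      _ ≤ 3 / 2 * (cE * AM * ((L - 1)⁻¹ * L ^ 2 * (L ^ k)⁻¹) + cE * BM * ((1 - L⁻¹ ^ 3)⁻¹ * L ^ k)) := by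
          refine mul_le_mul_of_nonneg_left (hsum.trans (add_le_add ?_ ?_)) (by norm_num)
          · exact mul_le_mul_of_nonneg_left h5a (by positivity)
          · exact mul_le_mul_of_nonneg_left h5b' (by positivity)
      _ = _ := by ring
  -- (T3)–(T5) per level `j`: `E_j ≤ 3∕2`, the localised rows, the deviation row
  have hper : ∀ j ∈ range k, CL * (E j * (ρ₁ ^ j * loc1 j
        + ∑ i ∈ range j, ρ₁ ^ (j - 1 - i) * (cE * (2 * (ρ₂ ^ i * E' i * loc0 j) + 2 * (td * dev i)))))
      ≤ CL * (3 / 2) * (2 * M₁ * (ρ₁ ^ j * (L ^ (j + 2) / L ^ k) ^ 3) + cG * GAP₁ * (ρ₁ ^ j * L ^ (2 * (j + 1)))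
          + cE * (9 / 2) * (2 * M₀') * ∑ i ∈ range j, ρ₁ ^ (j - 1 - i) * ρ₂ ^ i * (L ^ (j + 2) / L ^ k) ^ 3
          + cE * (9 / 2) * (cG * GAP₀) * ∑ i ∈ range j, ρ₁ ^ (j - 1 - i) * ρ₂ ^ i * L ^ (2 * (j + 1))
          + cE * (2 * td) * BD * ∑ i ∈ range j, ρ₁ ^ (j - 1 - i) * L ^ i) := by
    intro j hj
    have hjk := Finset.mem_range.mp hj
    have hin0 : 0 ≤ ρ₁ ^ j * loc1 j + ∑ i ∈ range j, ρ₁ ^ (j - 1 - i) * (cE * (2 * (ρ₂ ^ i * E' i * loc0 j) + 2 * (td * dev i))) := by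
      refine add_nonneg (mul_nonneg (pow_nonneg hρ₁0 _) (hloc10 j)) (Finset.sum_nonneg fun i _ => ?_)
      have := hE'0 i; have := hloc00 j; have := hdev0 i; positivity
    have hstep1 : E j * (ρ₁ ^ j * loc1 j + ∑ i ∈ range j, ρ₁ ^ (j - 1 - i) * (cE * (2 * (ρ₂ ^ i * E' i * loc0 j) + 2 * (td * dev i))))
        ≤ 3 / 2 * (ρ₁ ^ j * loc1 j + ∑ i ∈ range j, ρ₁ ^ (j - 1 - i) * (cE * (2 * (ρ₂ ^ i * E' i * loc0 j) + 2 * (td * dev i)))) :=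
      mul_le_mul_of_nonneg_right (hE j hjk.le) hin0
    have hl1 : ρ₁ ^ j * loc1 j ≤ 2 * M₁ * (ρ₁ ^ j * (L ^ (j + 2) / L ^ k) ^ 3) + cG * GAP₁ * (ρ₁ ^ j * L ^ (2 * (j + 1))) := by
      have h := mul_le_mul_of_nonneg_left (hLoc1 j hjk) (pow_nonneg hρ₁0 j)
      calc ρ₁ ^ j * loc1 j ≤ ρ₁ ^ j * (2 * (L ^ (j + 2) / L ^ k) ^ 3 * M₁ + cG * L ^ (2 * (j + 1)) * GAP₁) := h
        _ = _ := by ring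
    have hin : ∑ i ∈ range j, ρ₁ ^ (j - 1 - i) * (cE * (2 * (ρ₂ ^ i * E' i * loc0 j) + 2 * (td * dev i)))
        ≤ cE * (9 / 2) * (2 * M₀') * ∑ i ∈ range j, ρ₁ ^ (j - 1 - i) * ρ₂ ^ i * (L ^ (j + 2) / L ^ k) ^ 3
          + cE * (9 / 2) * (cG * GAP₀) * ∑ i ∈ range j, ρ₁ ^ (j - 1 - i) * ρ₂ ^ i * L ^ (2 * (j + 1))
          + cE * (2 * td) * BD * ∑ i ∈ range j, ρ₁ ^ (j - 1 - i) * L ^ i := by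
      rw [Finset.mul_sum, Finset.mul_sum, Finset.mul_sum, ← Finset.sum_add_distrib, ← Finset.sum_add_distrib]
      refine Finset.sum_le_sum fun i hi => ?_
      have hij := Finset.mem_range.mp hi
      have hik : i < k := hij.trans hjk
      have h1 : E' i * loc0 j ≤ 9 / 4 * (2 * (L ^ (j + 2) / L ^ k) ^ 3 * M₀' + cG * L ^ (2 * (j + 1)) * GAP₀) :=
        mul_le_mul (hE' i hik) (hLoc0 j hjk) (hloc00 j) (by norm_num)
      have h1' := mul_le_mul_of_nonneg_left h1 (show 0 ≤ ρ₁ ^ (j - 1 - i) * cE * 2 * ρ₂ ^ i by positivity)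
      have h2' := mul_le_mul_of_nonneg_left (hDev i hik) (show 0 ≤ ρ₁ ^ (j - 1 - i) * cE * 2 * td by positivity)
      have e1 : ρ₁ ^ (j - 1 - i) * (cE * (2 * (ρ₂ ^ i * E' i * loc0 j) + 2 * (td * dev i)))
          = ρ₁ ^ (j - 1 - i) * cE * 2 * ρ₂ ^ i * (E' i * loc0 j) + ρ₁ ^ (j - 1 - i) * cE * 2 * td * dev i := by ring
      rw [e1]
      refine (add_le_add h1' h2').trans (le_of_eq ?_)
      ring
    calc CL * (E j * (ρ₁ ^ j * loc1 j + ∑ i ∈ range j, ρ₁ ^ (j - 1 - i) * (cE * (2 * (ρ₂ ^ i * E' i * loc0 j) + 2 * (td * dev i)))))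
        ≤ CL * (3 / 2 * (ρ₁ ^ j * loc1 j + ∑ i ∈ range j, ρ₁ ^ (j - 1 - i) * (cE * (2 * (ρ₂ ^ i * E' i * loc0 j) + 2 * (td * dev i))))) :=
          mul_le_mul_of_nonneg_left hstep1 hCL
      _ ≤ CL * (3 / 2 * ((2 * M₁ * (ρ₁ ^ j * (L ^ (j + 2) / L ^ k) ^ 3) + cG * GAP₁ * (ρ₁ ^ j * L ^ (2 * (j + 1))))
            + (cE * (9 / 2) * (2 * M₀') * ∑ i ∈ range j, ρ₁ ^ (j - 1 - i) * ρ₂ ^ i * (L ^ (j + 2) / L ^ k) ^ 3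
              + cE * (9 / 2) * (cG * GAP₀) * ∑ i ∈ range j, ρ₁ ^ (j - 1 - i) * ρ₂ ^ i * L ^ (2 * (j + 1))
              + cE * (2 * td) * BD * ∑ i ∈ range j, ρ₁ ^ (j - 1 - i) * L ^ i))) :=
          mul_le_mul_of_nonneg_left (mul_le_mul_of_nonneg_left (add_le_add hl1 hin) (by norm_num)) hCL
      _ = _ := by ring
  -- sum over `j`; regroup; the level sums (R6)(R7)(R1)(R2)(R3)
  have hsumj := Finset.sum_le_sum hper
  have hregroup : ∑ j ∈ range k, (CL * (3 / 2) * (2 * M₁ * (ρ₁ ^ j * (L ^ (j + 2) / L ^ k) ^ 3) + cG * GAP₁ * (ρ₁ ^ j * L ^ (2 * (j + 1)))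
          + cE * (9 / 2) * (2 * M₀') * ∑ i ∈ range j, ρ₁ ^ (j - 1 - i) * ρ₂ ^ i * (L ^ (j + 2) / L ^ k) ^ 3
          + cE * (9 / 2) * (cG * GAP₀) * ∑ i ∈ range j, ρ₁ ^ (j - 1 - i) * ρ₂ ^ i * L ^ (2 * (j + 1))
          + cE * (2 * td) * BD * ∑ i ∈ range j, ρ₁ ^ (j - 1 - i) * L ^ i))
      = CL * (3 / 2) * (2 * M₁ * ∑ j ∈ range k, ρ₁ ^ j * (L ^ (j + 2) / L ^ k) ^ 3
          + cG * GAP₁ * ∑ j ∈ range k, ρ₁ ^ j * L ^ (2 * (j + 1))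
          + cE * (9 / 2) * (2 * M₀') * ∑ j ∈ range k, ∑ i ∈ range j, ρ₁ ^ (j - 1 - i) * ρ₂ ^ i * (L ^ (j + 2) / L ^ k) ^ 3
          + cE * (9 / 2) * (cG * GAP₀) * ∑ j ∈ range k, ∑ i ∈ range j, ρ₁ ^ (j - 1 - i) * ρ₂ ^ i * L ^ (2 * (j + 1))
          + cE * (2 * td) * BD * ∑ j ∈ range k, ∑ i ∈ range j, ρ₁ ^ (j - 1 - i) * L ^ i) := by
    rw [← Finset.mul_sum]
    simp only [Finset.sum_add_distrib, ← Finset.mul_sum]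
  have hR1 := row_R1 hL1 hρ₁0 hρ₁ hρ₂0 hρ₂ k
  have hR2 := row_R2 hL1 hρ₁0 hρ₁ hρ₂0 hρ₂ k
  have hR3 := row_R3 hL1 hρ₁0 hρ₁ k
  have hR6 := row_R6 hL hρ₁0 hρ₁ k
  have hR7 := row_R7 hL hρ₁0 hρ₁ k
  have hbig : 2 * M₁ * ∑ j ∈ range k, ρ₁ ^ j * (L ^ (j + 2) / L ^ k) ^ 3
          + cG * GAP₁ * ∑ j ∈ range k, ρ₁ ^ j * L ^ (2 * (j + 1))
          + cE * (9 / 2) * (2 * M₀') * ∑ j ∈ range k, ∑ i ∈ range j, ρ₁ ^ (j - 1 - i) * ρ₂ ^ i * (L ^ (j + 2) / L ^ k) ^ 3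
          + cE * (9 / 2) * (cG * GAP₀) * ∑ j ∈ range k, ∑ i ∈ range j, ρ₁ ^ (j - 1 - i) * ρ₂ ^ i * L ^ (2 * (j + 1))
          + cE * (2 * td) * BD * ∑ j ∈ range k, ∑ i ∈ range j, ρ₁ ^ (j - 1 - i) * L ^ i
      ≤ 2 * M₁ * (L ^ 6 / (L - 1) * (L ^ k)⁻¹) + cG * GAP₁ * (L ^ 2 * L ^ k)
          + cE * (9 / 2) * (2 * M₀') * (L ^ 8 / ((L ^ 2 - 1) * (L - 1)) * (L ^ k)⁻¹)
          + cE * (9 / 2) * (cG * GAP₀) * (L ^ 4 * ((L - 1) ^ 2)⁻¹ * L ^ k)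
          + cE * (2 * td) * BD * ((1 - L⁻¹ ^ 3)⁻¹ * (L - 1)⁻¹ * L ^ k) := by
    refine add_le_add (add_le_add (add_le_add (add_le_add ?_ ?_) ?_) ?_) ?_
    · exact mul_le_mul_of_nonneg_left hR6 (by positivity)
    · exact mul_le_mul_of_nonneg_left hR7 (by positivity)
    · exact mul_le_mul_of_nonneg_left hR1 (by positivity)
    · exact mul_le_mul_of_nonneg_left hR2 (by positivity)
    · exact mul_le_mul_of_nonneg_left hR3 (by positivity)
  have hCLpos : 0 ≤ CL * (3 / 2) := by positivity
  have hC := mul_le_mul_of_nonneg_left ((hsumj.trans_eq hregroup).trans (mul_le_mul_of_nonneg_left hbig hCLpos)) hCd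
  have hsplitE : E k * (ρ₁ ^ k * D0 + ∑ i ∈ range k, ρ₁ ^ (k - 1 - i) * (cE * mass i))
      = E k * (ρ₁ ^ k * D0) + E k * ∑ i ∈ range k, ρ₁ ^ (k - 1 - i) * (cE * mass i) := mul_add _ _ _
  rw [hsplitE]
  refine (add_le_add (add_le_add hT1 hT2) hC).trans (le_of_eq ?_)
  ring


/-! ## §3 Four scalar shapes of the member discharge (no arithmetic tactic ever sees the member's sums) -/

/-- `e^{2x} ≤ 9∕4` from `eˣ ≤ 3∕2`. [folklore] -/
theorem exp_two_mul_le_of {x : ℝ} (h : Real.exp x ≤ 3 / 2) : Real.exp (2 * x) ≤ 9 / 4 := by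
  rw [two_mul, Real.exp_add]
  nlinarith [Real.exp_pos x]

/-- the `iX`-gap numerals at `N = 2`, `d = 3`. [folklore] -/
theorem gapX_shape {G KX DX a M N' d' : ℝ} (hN : N' = 2) (hd : d' = 3)
    (h : G ≤ N' * (2 * KX + 32 * d' * a ^ 2 * M) + DX + 2 * d' * a * (N' * M)) :
    G ≤ 4 * KX + DX + (192 * a ^ 2 + 12 * a) * M := by
  subst hN hd; linarith

/-- the localised second-order level-0 channel: half of the localised `‖X‖²`-mass row. [folklore] -/
theorem loc1_shape {S1 S2 R M c P G GB : ℝ} (h1 : S1 ≤ 1 / 2 * S2) (h2 : S2 ≤ 2 * R * M + c * P * G) (hG : G ≤ GB) (hcP : 0 ≤ c * P) :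
    S1 ≤ 2 * R * (M / 2) + c * P * (GB / 2) := by
  nlinarith [mul_le_mul_of_nonneg_left hG hcP]

/-- the last step: the level-0 second-order mass `D₀ ≤ M∕2` inside the A-slot. [folklore] -/
theorem final_shape {Λ D0 Mh T2 T3 T4 B x y : ℝ} (h : Λ ≤ (3 / 2 * D0 + T2 + T3 + T4) * x + B * y) (hD : D0 ≤ Mh) (hx : 0 ≤ x) :
    Λ ≤ (3 / 2 * Mh + T2 + T3 + T4) * x + B * y := by
  nlinarith [mul_le_mul_of_nonneg_right hD hx]

end Real

end Summit.QuantumFields.YangMills.Theorems.Prop7N32SymLevelRowReals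

end
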